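import Literature.Computability.Cryptography.ChenQuantumLWECosetNonDemolition

/-!
# Adaptive composition of safe operations on the Step-9 line kets is class-blind (T4, operator form, adaptive)

REPRODUCTION / ANALYSIS OF A CLAIMED RESULT UNDER ADJUDICATION (withdrawn): Yilei Chen, *Quantum
Algorithms for Lattice Problems*, IACR ePrint 2024/555, version of 2024-04-18 [ChenQuantumLattice2024]
(the version carrying the author's note that Step 9 contains a bug), Step 9 (§3.5.9, pp. 34–38) acting
on the line ket `|φ8.b⟩ = Σ_{j ∈ ℤ_P} e(-j²/P) |2D²j·b + v′ mod N⟩` (p. 35), Claim 3.14 (pp. 33–34) and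
eq. (12) (p. 17).  Bundle `papers/QuantumAdvantage/lwe-quantum-autopsy/`, Part 2 (`REPAIR-CENSUS.md`
§1 **T4**, §12–§14), sequel of `ChenQuantumLWECosetNonDemolition.lean`.
HONEST FRAMING: kernel-checked THEOREMS about states occurring in a WITHDRAWN algorithm — the adaptive
form of a NO-GO for in-run repairs of Step 9, NOT summit progress, no cryptanalytic claim in either
direction, no new algorithm; quantum lower bounds are out of scope.

## What is proved

The two previous modules are single-operation statements: a linear operation that never destroys the
line ket of any instance the algorithm cannot exclude (`IsClassND`, resp. `IsCosetND` for the instances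
consistent with the line invariants and the Step-8 datum) acts on the whole knowable family as ONE
scalar (`IsCosetND.apply_eq_smul`).  The remaining sentence of the census's T4 was the ADAPTIVE one: an
in-run repair is a SEQUENCE of instruments, the instrument applied at each stage chosen as a function of
the outcomes observed so far, and its safety guarantee may likewise be conditioned on those outcomes.
This module types that sentence.

* `composedOp step h` — the branch operator `E^{(t)}_{h,k_t} ∘ ⋯ ∘ E^{(1)}_{[],k_1}` of an outcome
  history `h = [k_t, …, k_1]` (most recent outcome first) of an ADAPTIVE PROTOCOL
  `step : List K → K → (register →ₗ register)` (at history `h` the instrument `{step h k}_k` is applied;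
  a unitary or a coherent correction is the case of a one-outcome stage; no completeness relation
  `Σ_k E_k†E_k = 1` is assumed — dropping it only widens the class of protocols covered).
* `AdaptiveSafe U bk v′ step` — THE HYPOTHESIS: at every history `h` and for every branch `k`, the
  operator `step h k` is non-demolition on the CURRENT state `composedOp step h |φ_{b,w}⟩` of every
  instance `(b, w)` of the knowable family (class secret `b`, offset `w` in the knowable coset of `v′`)
  that is still CONSISTENT WITH THE HISTORY (current state `≠ 0`, i.e. the history has positive
  weight on that instance).  This is the weakest form of "the algorithm never risks destroying the state
  on an instance it cannot rule out from everything it has seen so far".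
* **`AdaptiveSafe.exists_eq_smul`** — for odd `P = p₁Q`, odd `Q`, `gcd(p₁,Q) = 1`, `0 ∉ U ≠ ∅`,
  `bk₀ = −1`: every composed branch acts on the WHOLE knowable family as one scalar,
  `composedOp step h |φ_{b,w}⟩ = c(h)·|φ_{b,w}⟩` (induction on the history; the step is
  `IsCosetND.apply_eq_smul` of `ChenQuantumLWECosetNonDemolition` applied to `step h k`, which the
  hypothesis makes coset-non-demolition as long as the family is alive, `AdaptiveSafe.isCosetND_step`).
* **`AdaptiveSafe.alive_all_or_none`** — hence the set of instances consistent with a history is all of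
  the knowable family or empty: THE KNOWABLE FAMILY NEVER SHRINKS along a safe adaptive protocol.
* **`AdaptiveSafe.histProb_indep`**, `Shape.adaptive_histProb_blind` — the Born weight of every history
  (`histProb`, total weight of the branch state over total weight of the input) is the same number
  `‖c(h)‖²` on every instance of the family: the TRANSCRIPT LAW of a safe adaptive protocol is blind to the
  secret's unknown coordinates and to the position of the offset in its knowable coset.
* `AdaptiveSafe.weight_composed`, **`AdaptiveSafe.weight_qft_composed`** — the surviving branch state IS
  the input line ket up to the scalar; in particular Fourier sampling after any safe adaptive prefix is
  still exactly flat (`|QFT(composedOp h |φ_{b,w}⟩)(u)|² = ‖c(h)‖²·P` for every `u`: T3 persists).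
* **`AdaptiveSafe.weight_qft_kick_composed`**, `sameCoset_centreShift`, `centreError_ne_of_centreShift`,
  **`AdaptiveSafe.kick_wrong_on_a_twin`** — running Chen's chirp-cancelling kick after a safe adaptive
  prefix with a guess `g(h)` computed from the transcript by ANY rule gives T5's law scaled by `‖c(h)‖²`
  (all Fourier weight on the hyperplane `⟨b,u⟩ = ε`, `ε` the centre error of the guess for the instance
  at hand); and for `gcd(D,Q) = 1`, `a ≢ 0 (mod Q)` the offsets `v′` and `v′ + d(a,0)` are twins — same
  knowable coset, same transcript law for every safe protocol — with DIFFERENT centres mod `P`, so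
  whatever the rule, at every history the guess is wrong (`ε ≠ 0`: zero weight on the homogeneous
  hyperplane Step 9 wants) on at least one of two instances the protocol cannot tell apart.
* `AdaptiveSafe.of_forall_isCosetND`, `isClassND_branchOp_of_isLineInvariant`,
  **`adaptiveSafe_harvest`** — non-vacuity: every protocol whose stages are coset-non-demolition
  operations is safe; in particular the ADAPTIVE HARVEST of line invariants (measure `{M_h, M_hᶜ}` for a
  line-invariant set `M_h` chosen from the outcomes so far, interleaved at will with Chen's Step-8
  stabiliser `step8Op`) is a safe adaptive protocol — and therefore, by the above, learns nothing beyond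
  the class.

## What is NOT here

Joint adaptive processing of the registers of SEVERAL runs (independent offsets, common secret): the
offset-oblivious case is `twirl_multiRun_indep` (`ChenQuantumLWEClassTwirl`); a tensor-product version of
`IsCosetND.apply_eq_smul` is not attempted.  Protocols that accept demolition on some consistent
instance are one-copy measurements, governed by the output-law / window / class-twirl modules.  The
bookkeeping that Steps 1–7 hand over no offset datum beyond Claim 3.14 (census T6).  Quantum query lower
bounds.
-/

namespace Literature.Computability.Cryptography.Chen2024

open scoped BigOperators

/-! ### Scalars through the register primitives -/

section General

variable {k m : ℕ}

/-- `QFT` is linear: `QFT(c·ψ) = c·QFT ψ`. [folklore] -/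
theorem qft_smul [NeZero m] (c : ℂ) (ψ : Ket k m) : qft (c • ψ) = c • qft ψ := by
  funext u
  simp only [qft, Pi.smul_apply, smul_eq_mul, Finset.mul_sum, mul_assoc]

/-- A phase kick commutes with scalars. [folklore] -/
theorem kick_smul (g : (Fin k → ZMod m) → ℚ) (c : ℂ) (ψ : Ket k m) : kick g (c • ψ) = c • kick g ψ := by
  funext z
  simp only [kick, Pi.smul_apply, smul_eq_mul, mul_assoc]

/-- Born weights scale by `‖c‖²`. [folklore] -/
theorem weight_smul (c : ℂ) (ψ : Ket k m) (u : Fin k → ZMod m) :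
    weight (c • ψ) u = ‖c‖ ^ 2 * weight ψ u := by
  simp only [weight, Pi.smul_apply, smul_eq_mul, norm_mul, mul_pow]

/-- Total Born weight scales by `‖c‖²`. [folklore] -/
theorem sum_weight_smul [NeZero m] (c : ℂ) (ψ : Ket k m) :
    ∑ u, weight (c • ψ) u = ‖c‖ ^ 2 * ∑ u, weight ψ u := by
  rw [Finset.mul_sum]
  exact Finset.sum_congr rfl fun u _ => weight_smul c ψ u

/-- Born weights are non-negative. [folklore] -/
theorem weight_nonneg' (ψ : Ket k m) (u : Fin k → ZMod m) : 0 ≤ weight ψ u := by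
  unfold weight; positivity

/-- Non-demolition passes to scalar multiples of the state. [folklore] -/
theorem IsNonDemolition.smul {E : Ket k m →ₗ[ℂ] Ket k m} {ψ : Ket k m} (h : IsNonDemolition E ψ)
    (c : ℂ) : IsNonDemolition E (c • ψ) := by
  obtain ⟨l, hl⟩ := h
  exact ⟨l, by rw [map_smul, hl, smul_comm]⟩

/-- Non-demolition on a NON-ZERO scalar multiple of the state is non-demolition on the state. [folklore] -/
theorem IsNonDemolition.of_smul {E : Ket k m →ₗ[ℂ] Ket k m} {ψ : Ket k m} {c : ℂ} (hc : c ≠ 0)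
    (h : IsNonDemolition E (c • ψ)) : IsNonDemolition E ψ := by
  obtain ⟨l, hl⟩ := h
  refine ⟨l, ?_⟩
  rw [map_smul, smul_comm] at hl
  have h' := congrArg (fun φ : Ket k m => c⁻¹ • φ) hl
  simpa only [inv_smul_smul₀ hc] using h'

end General

/-! ### Adaptive protocols: composed branch operators and history weights -/

section Protocol

variable {K : Type*} {V : Type*} [AddCommMonoid V] [Module ℂ V]

/-- THE COMPOSED BRANCH OPERATOR of an outcome history of an adaptive protocol.  `step h k` is the Kraus
operator of outcome `k` of the instrument applied when the outcomes observed so far are `h` (a list,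
MOST RECENT FIRST); `composedOp step [k_t, …, k_1] = step [k_{t-1},…,k_1] k_t ∘ ⋯ ∘ step [] k_1`.
[folklore] -/
def composedOp (step : List K → K → (V →ₗ[ℂ] V)) : List K → (V →ₗ[ℂ] V)
  | [] => LinearMap.id
  | κ :: h => step h κ ∘ₗ composedOp step h

/-- The empty history does nothing. [folklore] -/
@[simp] theorem composedOp_nil (step : List K → K → (V →ₗ[ℂ] V)) :
    composedOp step [] = LinearMap.id := rfl

/-- One more stage. [folklore] -/
@[simp] theorem composedOp_cons (step : List K → K → (V →ₗ[ℂ] V)) (κ : K) (h : List K) :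
    composedOp step (κ :: h) = step h κ ∘ₗ composedOp step h := rfl

/-- One more stage, applied. [folklore] -/
theorem composedOp_cons_apply (step : List K → K → (V →ₗ[ℂ] V)) (κ : K) (h : List K) (ψ : V) :
    composedOp step (κ :: h) ψ = step h κ (composedOp step h ψ) := rfl

variable {k m : ℕ}

/-- THE BORN WEIGHT OF A HISTORY on the input `ψ`: total weight of the (unnormalised) branch state over
the total weight of `ψ` — for a sequence of complete instruments, the probability of observing `h`.
[folklore] -/
noncomputable def histProb [NeZero m] (step : List K → K → (Ket k m →ₗ[ℂ] Ket k m)) (h : List K)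
    (ψ : Ket k m) : ℝ :=
  (∑ u, weight (composedOp step h ψ) u) / ∑ u, weight ψ u

/-- If the branch state is `c·ψ` and `ψ ≠ 0` has positive total weight, the history has Born weight
`‖c‖²`. [folklore] -/
theorem histProb_eq_of_eq_smul [NeZero m] {step : List K → K → (Ket k m →ₗ[ℂ] Ket k m)} {h : List K}
    {ψ : Ket k m} {c : ℂ} (hc : composedOp step h ψ = c • ψ) (hψ : 0 < ∑ u, weight ψ u) :
    histProb step h ψ = ‖c‖ ^ 2 := by
  rw [histProb, hc, sum_weight_smul, mul_div_assoc, div_self hψ.ne', mul_one]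

end Protocol

/-! ### Safe adaptive protocols on the knowable family -/

section Adaptive

variable (n : ℕ) (D p₁ Q : ℕ+)

/-- The line ket is not the zero vector (it is `1` at its offset). [folklore] -/
theorem phi8bKet_ne_zero (b v' : Fin (n + 1) → ℤ) (hP : Odd ((p₁ * Q : ℕ+) : ℕ)) (hb : b 0 = -1) :
    phi8bKet n D p₁ Q b v' ≠ 0 := by
  intro h
  have h1 := phi8bKet_apply_offset n D p₁ Q b v' hP hb
  rw [h, Pi.zero_apply] at h1
  exact zero_ne_one h1

/-- The line ket has positive total Born weight. [folklore] -/
theorem sum_weight_phi8bKet_pos (b v' : Fin (n + 1) → ℤ) (hP : Odd ((p₁ * Q : ℕ+) : ℕ))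
    (hb : b 0 = -1) : 0 < ∑ u, weight (phi8bKet n D p₁ Q b v') u := by
  have h1 : weight (phi8bKet n D p₁ Q b v') (fun i => ((v' i : ℤ) : ZN D p₁ Q)) = 1 := by
    rw [weight, phi8bKet_apply_offset n D p₁ Q b v' hP hb, norm_one, one_pow]
  calc (0 : ℝ) < 1 := one_pos
    _ = weight (phi8bKet n D p₁ Q b v') (fun i => ((v' i : ℤ) : ZN D p₁ Q)) := h1.symm
    _ ≤ ∑ u, weight (phi8bKet n D p₁ Q b v') u :=
        Finset.single_le_sum (fun u _ => weight_nonneg' _ u) (Finset.mem_univ _)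

/-- **A SAFE ADAPTIVE PROTOCOL** on the run's state `|φ8.b⟩ = |φ_{b,v′}⟩`: at every outcome history
`h` and for every branch `k` of the instrument then applied, the operator `step h k` is non-demolition
on the CURRENT state of every instance of the knowable family — class secret `b` (`InClass`), offset
`w` in the knowable coset of `v′` (`SameCoset`) — that is still consistent with the history (current
branch state non-zero).  The algorithm's safety guarantee is thus allowed to depend on everything it
has observed. [cite: ChenQuantumLattice2024, §3.5.9 pp. 34–38, Claim 3.14 pp. 33–34, eq. (12) p. 17] -/
def AdaptiveSafe {K : Type*} (U : Finset (Fin (n + 1))) (bk v' : Fin (n + 1) → ℤ)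
    (step : List K → K →
      (Ket (n + 1) ((D * D * (p₁ * Q) : ℕ+) : ℕ) →ₗ[ℂ] Ket (n + 1) ((D * D * (p₁ * Q) : ℕ+) : ℕ))) :
    Prop :=
  ∀ (h : List K) (κ : K) (b w : Fin (n + 1) → ℤ), InClass n p₁ U bk b → SameCoset n D p₁ Q U bk v' w →
    composedOp step h (phi8bKet n D p₁ Q b w) ≠ 0 →
      IsNonDemolition (step h κ) (composedOp step h (phi8bKet n D p₁ Q b w))

variable {n D p₁ Q}
variable {K : Type*} {U : Finset (Fin (n + 1))} {bk v' : Fin (n + 1) → ℤ}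
variable {step : List K → K →
  (Ket (n + 1) ((D * D * (p₁ * Q) : ℕ+) : ℕ) →ₗ[ℂ] Ket (n + 1) ((D * D * (p₁ * Q) : ℕ+) : ℕ))}

/-- The inductive step: if the composed branch of `h` acts on the knowable family as a NON-ZERO scalar,
safety makes every branch operator of the next stage coset-non-demolition at `v′` — so the whole theory
of `ChenQuantumLWECosetNonDemolition` applies to it. [cite: ChenQuantumLattice2024, §3.5.9 pp. 34–38] -/
theorem AdaptiveSafe.isCosetND_of_eq_smul (hS : AdaptiveSafe n D p₁ Q U bk v' step)
    (hP : Odd ((p₁ * Q : ℕ+) : ℕ)) (hU : (0 : Fin (n + 1)) ∉ U) (hbk0 : bk 0 = -1) {h : List K} {c : ℂ}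
    (hc : ∀ b w, InClass n p₁ U bk b → SameCoset n D p₁ Q U bk v' w →
      composedOp step h (phi8bKet n D p₁ Q b w) = c • phi8bKet n D p₁ Q b w)
    (hc0 : c ≠ 0) (κ : K) : IsCosetND n D p₁ Q U bk v' (step h κ) := by
  intro b hb w hw
  have hb0 : b 0 = -1 := InClass.apply_zero n p₁ hU hbk0 hb
  have hne : composedOp step h (phi8bKet n D p₁ Q b w) ≠ 0 := by
    rw [hc b w hb hw]
    exact smul_ne_zero hc0 (phi8bKet_ne_zero n D p₁ Q b w hP hb0)
  have hnd := hS h κ b w hb hw hne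
  rw [hc b w hb hw] at hnd
  exact hnd.of_smul hc0

/-- **T4, adaptive form.**  For odd `P`, odd `Q`, `gcd(p₁,Q) = 1`, `0 ∉ U ≠ ∅`, `bk₀ = −1`: along a
safe adaptive protocol EVERY composed branch acts on the whole knowable family as ONE scalar,
`composedOp step h |φ_{b,w}⟩ = c(h)·|φ_{b,w}⟩` for every class secret `b` and every `w` in the knowable
coset of `v′`. [cite: ChenQuantumLattice2024, §3.5.9 pp. 34–38, Claim 3.14 pp. 33–34, eq. (12) p. 17] -/
theorem AdaptiveSafe.exists_eq_smul (hS : AdaptiveSafe n D p₁ Q U bk v' step)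
    (hP : Odd ((p₁ * Q : ℕ+) : ℕ)) (hQ : Odd ((Q : ℕ+) : ℕ)) (hpQ : Nat.Coprime (p₁ : ℕ) (Q : ℕ))
    (hU : (0 : Fin (n + 1)) ∉ U) (hU' : U.Nonempty) (hbk0 : bk 0 = -1) (h : List K) :
    ∃ c : ℂ, ∀ b w, InClass n p₁ U bk b → SameCoset n D p₁ Q U bk v' w →
      composedOp step h (phi8bKet n D p₁ Q b w) = c • phi8bKet n D p₁ Q b w := by
  induction h with
  | nil => exact ⟨1, fun b w _ _ => by rw [composedOp_nil, LinearMap.id_apply, one_smul]⟩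
  | cons κ h ih =>
    obtain ⟨c, hc⟩ := ih
    by_cases hfam : ∃ b, InClass n p₁ U bk b
    · obtain ⟨b₁, hb₁⟩ := hfam
      by_cases hc0 : c = 0
      · refine ⟨0, fun b w hb hw => ?_⟩
        rw [composedOp_cons_apply, hc b w hb hw, hc0, zero_smul, map_zero]
      · have hE : IsCosetND n D p₁ Q U bk v' (step h κ) := hS.isCosetND_of_eq_smul hP hU hbk0 hc hc0 κ
        refine ⟨c * ndValue n D p₁ Q (step h κ) b₁ v', fun b w hb hw => ?_⟩
        rw [composedOp_cons_apply, hc b w hb hw, map_smul,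
          hE.apply_eq_smul hP hQ hpQ hU hU' hbk0 hb₁ hb hw, smul_smul]
    · exact ⟨0, fun b w hb _ => absurd ⟨b, hb⟩ hfam⟩

/-- **The knowable family never shrinks.**  After any history of a safe adaptive protocol, either EVERY
instance of the knowable family is still consistent with it (non-zero branch state) or NONE is (the
history has weight zero on all of them): outcomes never separate instances of the family.
[cite: ChenQuantumLattice2024, §3.5.9 pp. 34–38, Claim 3.14 pp. 33–34] -/
theorem AdaptiveSafe.alive_all_or_none (hS : AdaptiveSafe n D p₁ Q U bk v' step)
    (hP : Odd ((p₁ * Q : ℕ+) : ℕ)) (hQ : Odd ((Q : ℕ+) : ℕ)) (hpQ : Nat.Coprime (p₁ : ℕ) (Q : ℕ))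
    (hU : (0 : Fin (n + 1)) ∉ U) (hU' : U.Nonempty) (hbk0 : bk 0 = -1) (h : List K) :
    (∀ b w, InClass n p₁ U bk b → SameCoset n D p₁ Q U bk v' w →
        composedOp step h (phi8bKet n D p₁ Q b w) ≠ 0) ∨
      (∀ b w, InClass n p₁ U bk b → SameCoset n D p₁ Q U bk v' w →
        composedOp step h (phi8bKet n D p₁ Q b w) = 0) := by
  obtain ⟨c, hc⟩ := hS.exists_eq_smul hP hQ hpQ hU hU' hbk0 h
  by_cases hc0 : c = 0
  · exact Or.inr fun b w hb hw => by rw [hc b w hb hw, hc0, zero_smul]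
  · exact Or.inl fun b w hb hw => by
      rw [hc b w hb hw]
      exact smul_ne_zero hc0 (phi8bKet_ne_zero n D p₁ Q b w hP (InClass.apply_zero n p₁ hU hbk0 hb))

/-- **Every stage of a live history is coset-non-demolition.**  If some instance of the knowable family
is still consistent with the history `h`, every branch operator `step h k` of the next stage is
coset-non-demolition at `v′` (so its eigenvalue is class-blind, `IsCosetND.ndValue_eq_of_sameCoset`).
[cite: ChenQuantumLattice2024, §3.5.9 pp. 34–38] -/
theorem AdaptiveSafe.isCosetND_step (hS : AdaptiveSafe n D p₁ Q U bk v' step)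
    (hP : Odd ((p₁ * Q : ℕ+) : ℕ)) (hQ : Odd ((Q : ℕ+) : ℕ)) (hpQ : Nat.Coprime (p₁ : ℕ) (Q : ℕ))
    (hU : (0 : Fin (n + 1)) ∉ U) (hU' : U.Nonempty) (hbk0 : bk 0 = -1) {h : List K}
    {b₀ w₀ : Fin (n + 1) → ℤ} (hb₀ : InClass n p₁ U bk b₀) (hw₀ : SameCoset n D p₁ Q U bk v' w₀)
    (hlive : composedOp step h (phi8bKet n D p₁ Q b₀ w₀) ≠ 0) (κ : K) :
    IsCosetND n D p₁ Q U bk v' (step h κ) := by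
  obtain ⟨c, hc⟩ := hS.exists_eq_smul hP hQ hpQ hU hU' hbk0 h
  have hc0 : c ≠ 0 := by
    intro h0
    rw [hc b₀ w₀ hb₀ hw₀, h0, zero_smul] at hlive
    exact hlive rfl
  exact hS.isCosetND_of_eq_smul hP hU hbk0 hc hc0 κ

/-- **The transcript law is one number per history.** [cite: ChenQuantumLattice2024, §3.5.9 pp. 34–38] -/
theorem AdaptiveSafe.exists_histProb_eq (hS : AdaptiveSafe n D p₁ Q U bk v' step)
    (hP : Odd ((p₁ * Q : ℕ+) : ℕ)) (hQ : Odd ((Q : ℕ+) : ℕ)) (hpQ : Nat.Coprime (p₁ : ℕ) (Q : ℕ))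
    (hU : (0 : Fin (n + 1)) ∉ U) (hU' : U.Nonempty) (hbk0 : bk 0 = -1) (h : List K) :
    ∃ p : ℝ, ∀ b w, InClass n p₁ U bk b → SameCoset n D p₁ Q U bk v' w →
      histProb step h (phi8bKet n D p₁ Q b w) = p := by
  obtain ⟨c, hc⟩ := hS.exists_eq_smul hP hQ hpQ hU hU' hbk0 h
  exact ⟨‖c‖ ^ 2, fun b w hb hw => histProb_eq_of_eq_smul (hc b w hb hw)
    (sum_weight_phi8bKet_pos n D p₁ Q b w hP (InClass.apply_zero n p₁ hU hbk0 hb))⟩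

/-- **T4, adaptive form, as a statement about transcripts.**  The Born weight of every outcome history
of a safe adaptive protocol is the same on `|φ_{b,w}⟩` and on `|φ_{b′,w′}⟩` for any two class secrets
and any two offsets of the knowable coset: the transcript is blind to the secret's unknown coordinates
and to where in its knowable coset the offset lies. [cite: ChenQuantumLattice2024, §3.5.9 pp. 34–38, Claim 3.14 pp. 33–34, eq. (12) p. 17] -/
theorem AdaptiveSafe.histProb_indep (hS : AdaptiveSafe n D p₁ Q U bk v' step)
    (hP : Odd ((p₁ * Q : ℕ+) : ℕ)) (hQ : Odd ((Q : ℕ+) : ℕ)) (hpQ : Nat.Coprime (p₁ : ℕ) (Q : ℕ))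
    (hU : (0 : Fin (n + 1)) ∉ U) (hU' : U.Nonempty) (hbk0 : bk 0 = -1) (h : List K)
    {b w b' w' : Fin (n + 1) → ℤ} (hb : InClass n p₁ U bk b) (hw : SameCoset n D p₁ Q U bk v' w)
    (hb' : InClass n p₁ U bk b') (hw' : SameCoset n D p₁ Q U bk v' w') :
    histProb step h (phi8bKet n D p₁ Q b w) = histProb step h (phi8bKet n D p₁ Q b' w') := by
  obtain ⟨p, hp⟩ := hS.exists_histProb_eq hP hQ hpQ hU hU' hbk0 h
  rw [hp b w hb hw, hp b' w' hb' hw']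

/-- **The surviving branch state is the input line ket** (up to the scalar): its computational-basis
weights are those of `|φ_{b,w}⟩` times `‖c(h)‖²`. [cite: ChenQuantumLattice2024, §3.5.9 p. 35] -/
theorem AdaptiveSafe.weight_composed (hS : AdaptiveSafe n D p₁ Q U bk v' step)
    (hP : Odd ((p₁ * Q : ℕ+) : ℕ)) (hQ : Odd ((Q : ℕ+) : ℕ)) (hpQ : Nat.Coprime (p₁ : ℕ) (Q : ℕ))
    (hU : (0 : Fin (n + 1)) ∉ U) (hU' : U.Nonempty) (hbk0 : bk 0 = -1) (h : List K) :
    ∃ c : ℂ, ∀ b w, InClass n p₁ U bk b → SameCoset n D p₁ Q U bk v' w →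
      ∀ u, weight (composedOp step h (phi8bKet n D p₁ Q b w)) u = ‖c‖ ^ 2 * weight (phi8bKet n D p₁ Q b w) u := by
  obtain ⟨c, hc⟩ := hS.exists_eq_smul hP hQ hpQ hU hU' hbk0 h
  exact ⟨c, fun b w hb hw u => by rw [hc b w hb hw, weight_smul]⟩

/-- **T3 persists after any safe adaptive prefix.**  Fourier sampling of the surviving branch state is
exactly flat: `|QFT(composedOp h |φ_{b,w}⟩)(u)|² = ‖c(h)‖²·P` for every `u`, every class secret and every
offset of the knowable coset. [cite: ChenQuantumLattice2024, §3.5.9 p. 35; Korobov1992, Ch. I §3 Thm 3] -/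
theorem AdaptiveSafe.weight_qft_composed (hS : AdaptiveSafe n D p₁ Q U bk v' step)
    (hP : Odd ((p₁ * Q : ℕ+) : ℕ)) (hQ : Odd ((Q : ℕ+) : ℕ)) (hpQ : Nat.Coprime (p₁ : ℕ) (Q : ℕ))
    (hU : (0 : Fin (n + 1)) ∉ U) (hU' : U.Nonempty) (hbk0 : bk 0 = -1) (h : List K) :
    ∃ c : ℂ, ∀ b w, InClass n p₁ U bk b → SameCoset n D p₁ Q U bk v' w →
      ∀ u, weight (qft (composedOp step h (phi8bKet n D p₁ Q b w))) u
        = ‖c‖ ^ 2 * ((p₁ * Q : ℕ+) : ℕ) := by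
  obtain ⟨c, hc⟩ := hS.exists_eq_smul hP hQ hpQ hU hU' hbk0 h
  exact ⟨c, fun b w hb hw u => by
    rw [hc b w hb hw, qft_smul, weight_smul, weight_qft_phi8bKet n D p₁ Q b w hP u]⟩

/-- **Chen's kick after a safe adaptive prefix, with a transcript-computed guess.**  Cancelling the
chirp with a guess `g(h)` for `v′₀` computed from the observed history by any rule `g`, then Fourier
sampling, puts ALL weight of the branch on the hyperplane `⟨b,u⟩ = ε(w, g h)` — T5's law
(`weight_qft_kick_phi8bKet`) times `‖c(h)‖²`, with `ε` the centre error of the guess FOR THE INSTANCE AT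
HAND. [cite: ChenQuantumLattice2024, Lemma 2.13 p. 13, §3.5 p. 22, §3.5.9 p. 35] -/
theorem AdaptiveSafe.weight_qft_kick_composed (hS : AdaptiveSafe n D p₁ Q U bk v' step)
    (hP : Odd ((p₁ * Q : ℕ+) : ℕ)) (hQ : Odd ((Q : ℕ+) : ℕ)) (hpQ : Nat.Coprime (p₁ : ℕ) (Q : ℕ))
    (hU : (0 : Fin (n + 1)) ∉ U) (hU' : U.Nonempty) (hbk0 : bk 0 = -1)
    (hunit : IsUnit ((2 * D * D : ℕ) : ZP p₁ Q)) (g : List K → ZN D p₁ Q) (h : List K) :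
    ∃ c : ℂ, ∀ b w, InClass n p₁ U bk b → SameCoset n D p₁ Q U bk v' w →
      ∀ u, weight (qft (kick (oracleKick n D p₁ Q (g h)) (composedOp step h (phi8bKet n D p₁ Q b w)))) u
        = ‖c‖ ^ 2 * (if lineFun n D p₁ Q b u = centreError n D p₁ Q w (g h)
            then ((((p₁ * Q : ℕ+) : ℕ) : ℝ)) ^ 2 else 0) := by
  obtain ⟨c, hc⟩ := hS.exists_eq_smul hP hQ hpQ hU hU' hbk0 h
  exact ⟨c, fun b w hb hw u => by
    rw [hc b w hb hw, kick_smul, qft_smul, weight_smul,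
      weight_qft_kick_phi8bKet n D p₁ Q b w hP (InClass.apply_zero n p₁ hU hbk0 hb) hunit (g h) u]⟩

/-! ### Twins with different centres -/

variable (n D p₁ Q)

/-- The offset `v′ + d(a,0)`: same knowable coset, centre moved by `−D²p₁a` on coordinate `0`.
[cite: ChenQuantumLattice2024, Claim 3.14 pp. 33–34] -/
def centreShift (U : Finset (Fin (n + 1))) (bk v' : Fin (n + 1) → ℤ) (a : ZQ Q) : Fin (n + 1) → ℤ :=
  fun i => v' i + classShift n D p₁ Q U bk a 0 i

/-- `v′ + d(a,0)` lies in the knowable coset of `v′`. [folklore] -/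
theorem sameCoset_centreShift (U : Finset (Fin (n + 1))) (bk v' : Fin (n + 1) → ℤ) (a : ZQ Q) :
    SameCoset n D p₁ Q U bk v' (centreShift n D p₁ Q U bk v' a) :=
  ⟨a, 0, fun _ => rfl⟩

/-- On coordinate `0 ∉ U` (`bk₀ = −1`) the shifted offset is `v′₀ − D²p₁·a`. [folklore] -/
theorem centreShift_zero {U : Finset (Fin (n + 1))} (hU : (0 : Fin (n + 1)) ∉ U) {bk : Fin (n + 1) → ℤ}
    (hbk0 : bk 0 = -1) (v' : Fin (n + 1) → ℤ) (a : ZQ Q) :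
    centreShift n D p₁ Q U bk v' a 0 = v' 0 - ((D : ℕ) : ℤ) ^ 2 * ((p₁ : ℕ) : ℤ) * ((a.val : ℕ) : ℤ) := by
  simp only [centreShift, classShift, classTail, if_neg hU, hbk0, Nat.cast_zero]
  ring

/-- For `gcd(D,Q) = 1` and `a ≢ 0 (mod Q)`, `D²p₁a ≢ 0 (mod P)`. [folklore] -/
theorem Dsq_p₁_mul_ne_zero (hDQ : Nat.Coprime (D : ℕ) (Q : ℕ)) {a : ZQ Q} (ha : a ≠ 0) :
    ((((D : ℕ) : ℤ) ^ 2 * ((p₁ : ℕ) : ℤ) * ((a.val : ℕ) : ℤ) : ℤ) : ZP p₁ Q) ≠ 0 := by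
  intro h
  rw [ZMod.intCast_zmod_eq_zero_iff_dvd] at h
  have h1 : (((p₁ : ℕ) * (Q : ℕ) : ℕ) : ℤ) ∣ ((p₁ : ℕ) : ℤ) * (((D : ℕ) : ℤ) ^ 2 * ((a.val : ℕ) : ℤ)) := by
    have e : (((p₁ * Q : ℕ+) : ℕ) : ℤ) = (((p₁ : ℕ) * (Q : ℕ) : ℕ) : ℤ) := by rw [PNat.mul_coe]
    rw [← e]
    have e2 : ((D : ℕ) : ℤ) ^ 2 * ((p₁ : ℕ) : ℤ) * ((a.val : ℕ) : ℤ)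
        = ((p₁ : ℕ) : ℤ) * (((D : ℕ) : ℤ) ^ 2 * ((a.val : ℕ) : ℤ)) := by ring
    rwa [e2] at h
  rw [Nat.cast_mul] at h1
  have hp : ((p₁ : ℕ) : ℤ) ≠ 0 := by exact_mod_cast (PNat.ne_zero p₁)
  have h2 : ((Q : ℕ) : ℤ) ∣ ((D : ℕ) : ℤ) ^ 2 * ((a.val : ℕ) : ℤ) := (mul_dvd_mul_iff_left hp).1 h1
  have h3 : ((Q : ℕ) : ℤ) ∣ ((a.val : ℕ) : ℤ) := by
    have hcop : IsCoprime ((Q : ℕ) : ℤ) (((D : ℕ) : ℤ) ^ 2) :=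
      (Nat.isCoprime_iff_coprime.2 hDQ.symm).pow_right
    exact hcop.dvd_of_dvd_mul_left h2
  have h4 : (Q : ℕ) ∣ a.val := by exact_mod_cast h3
  have h5 : a.val < (Q : ℕ) := ZMod.val_lt a
  have h6 : a.val = 0 := Nat.eq_zero_of_dvd_of_lt h4 h5
  exact ha ((ZMod.val_eq_zero a).1 h6)

/-- **Twins have different centres.**  For `gcd(D,Q) = 1`, `0 ∉ U`, `bk₀ = −1`, `a ≢ 0 (mod Q)`: the
centres `v′₀ mod P` and `(v′ + d(a,0))₀ mod P` — the data Chen's kick needs for the two instances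
(`oracleKick_congr`, `centreError_eq_zero_iff`) — DIFFER; equivalently no guess `w0` is right for both.
[cite: ChenQuantumLattice2024, §3.5 p. 22, §3.5.9 p. 35, Claim 3.14 pp. 33–34] -/
theorem centreError_ne_of_centreShift (hDQ : Nat.Coprime (D : ℕ) (Q : ℕ)) {U : Finset (Fin (n + 1))}
    (hU : (0 : Fin (n + 1)) ∉ U) {bk : Fin (n + 1) → ℤ} (hbk0 : bk 0 = -1) (v' : Fin (n + 1) → ℤ)
    {a : ZQ Q} (ha : a ≠ 0) (hunit : IsUnit ((2 * D * D : ℕ) : ZP p₁ Q)) (w0 : ZN D p₁ Q) :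
    ¬ (centreError n D p₁ Q v' w0 = 0 ∧ centreError n D p₁ Q (centreShift n D p₁ Q U bk v' a) w0 = 0) := by
  rintro ⟨h1, h2⟩
  rw [centreError_eq_zero_iff n D p₁ Q _ hunit] at h1 h2
  have h3 : toP D (p₁ * Q) (((v' 0 : ℤ) : ZN D p₁ Q))
      = toP D (p₁ * Q) (((centreShift n D p₁ Q U bk v' a 0 : ℤ) : ZN D p₁ Q)) := h1.symm.trans h2
  rw [map_intCast, map_intCast, centreShift_zero n D p₁ Q hU hbk0, Int.cast_sub, eq_sub_iff_add_eq,
    add_eq_left] at h3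
  exact Dsq_p₁_mul_ne_zero D p₁ Q hDQ ha h3

variable {n D p₁ Q}

/-- **No safe adaptive protocol supplies Step 9's datum.**  For `gcd(D,Q) = 1` and `a ≢ 0 (mod Q)` the
instances `(b, v′)` and `(b, v′ + d(a,0))` are twins: every outcome history of a safe adaptive protocol
has the SAME Born weight on both — and yet, whatever rule `g` turns the observed history into a guess
for the centre, at every history the kick with that guess is WRONG (centre error `≠ 0`: by
`AdaptiveSafe.weight_qft_kick_composed`, zero weight on the homogeneous hyperplane `⟨b,u⟩ = 0` that
Step 9 wants) on at least one of the two. [cite: ChenQuantumLattice2024, §3.5 p. 22, §3.5.9 pp. 34–38, Claim 3.14 pp. 33–34] -/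
theorem AdaptiveSafe.kick_wrong_on_a_twin (hS : AdaptiveSafe n D p₁ Q U bk v' step)
    (hP : Odd ((p₁ * Q : ℕ+) : ℕ)) (hQ : Odd ((Q : ℕ+) : ℕ)) (hpQ : Nat.Coprime (p₁ : ℕ) (Q : ℕ))
    (hDQ : Nat.Coprime (D : ℕ) (Q : ℕ)) (hU : (0 : Fin (n + 1)) ∉ U) (hU' : U.Nonempty)
    (hbk0 : bk 0 = -1) (hunit : IsUnit ((2 * D * D : ℕ) : ZP p₁ Q)) {b : Fin (n + 1) → ℤ}
    (hb : InClass n p₁ U bk b) {a : ZQ Q} (ha : a ≠ 0) (g : List K → ZN D p₁ Q) (h : List K) :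
    histProb step h (phi8bKet n D p₁ Q b v')
        = histProb step h (phi8bKet n D p₁ Q b (centreShift n D p₁ Q U bk v' a)) ∧
      (centreError n D p₁ Q v' (g h) ≠ 0 ∨
        centreError n D p₁ Q (centreShift n D p₁ Q U bk v' a) (g h) ≠ 0) := by
  refine ⟨hS.histProb_indep hP hQ hpQ hU hU' hbk0 h hb (sameCoset_refl v') hb
    (sameCoset_centreShift n D p₁ Q U bk v' a), ?_⟩
  by_contra hcon
  simp only [not_or, ne_eq, not_not] at hcon
  exact centreError_ne_of_centreShift n D p₁ Q hDQ hU hbk0 v' ha hunit (g h) hcon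

/-! ### Non-vacuity: stagewise coset-non-demolition protocols, and the adaptive harvest -/

/-- A protocol all of whose stages are coset-non-demolition at `v′` acts by scalars on the knowable
family. [cite: ChenQuantumLattice2024, §3.5.9 pp. 34–38] -/
theorem exists_eq_smul_of_forall_isCosetND (hE : ∀ (h : List K) (κ : K), IsCosetND n D p₁ Q U bk v' (step h κ))
    (hP : Odd ((p₁ * Q : ℕ+) : ℕ)) (hQ : Odd ((Q : ℕ+) : ℕ)) (hpQ : Nat.Coprime (p₁ : ℕ) (Q : ℕ))
    (hU : (0 : Fin (n + 1)) ∉ U) (hU' : U.Nonempty) (hbk0 : bk 0 = -1) (h : List K) :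
    ∃ c : ℂ, ∀ b w, InClass n p₁ U bk b → SameCoset n D p₁ Q U bk v' w →
      composedOp step h (phi8bKet n D p₁ Q b w) = c • phi8bKet n D p₁ Q b w := by
  induction h with
  | nil => exact ⟨1, fun b w _ _ => by rw [composedOp_nil, LinearMap.id_apply, one_smul]⟩
  | cons κ h ih =>
    obtain ⟨c, hc⟩ := ih
    by_cases hfam : ∃ b, InClass n p₁ U bk b
    · obtain ⟨b₁, hb₁⟩ := hfam
      refine ⟨c * ndValue n D p₁ Q (step h κ) b₁ v', fun b w hb hw => ?_⟩
      rw [composedOp_cons_apply, hc b w hb hw, map_smul,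
        (hE h κ).apply_eq_smul hP hQ hpQ hU hU' hbk0 hb₁ hb hw, smul_smul]
    · exact ⟨0, fun b w hb _ => absurd ⟨b, hb⟩ hfam⟩

/-- **Stagewise coset-non-demolition protocols are safe adaptive protocols.**
[cite: ChenQuantumLattice2024, §3.5.9 pp. 34–38] -/
theorem AdaptiveSafe.of_forall_isCosetND (hE : ∀ (h : List K) (κ : K), IsCosetND n D p₁ Q U bk v' (step h κ))
    (hP : Odd ((p₁ * Q : ℕ+) : ℕ)) (hQ : Odd ((Q : ℕ+) : ℕ)) (hpQ : Nat.Coprime (p₁ : ℕ) (Q : ℕ))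
    (hU : (0 : Fin (n + 1)) ∉ U) (hU' : U.Nonempty) (hbk0 : bk 0 = -1) :
    AdaptiveSafe n D p₁ Q U bk v' step := by
  intro h κ b w hb hw _
  obtain ⟨c, hc⟩ := exists_eq_smul_of_forall_isCosetND hE hP hQ hpQ hU hU' hbk0 h
  rw [hc b w hb hw]
  exact (hE h κ b hb w hw).smul c

variable (n D p₁ Q)

/-- The branch `𝟙_M` of a LINE-INVARIANT set `M` is class-non-demolition (odd `P`, `0 ∉ U`, `bk₀ = −1`).
[cite: ChenQuantumLattice2024, §3.5.9 p. 35, eq. (12) p. 17] -/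
theorem isClassND_branchOp_of_isLineInvariant (hP : Odd ((p₁ * Q : ℕ+) : ℕ)) {U : Finset (Fin (n + 1))}
    (hU : (0 : Fin (n + 1)) ∉ U) {bk : Fin (n + 1) → ℤ} (hbk0 : bk 0 = -1)
    {M : Set (Fin (n + 1) → ZN D p₁ Q)} (hM : IsLineInvariant n D p₁ Q U bk (fun x => x ∈ M)) :
    IsClassND n D p₁ Q U bk (branchOp M) := fun b hb w =>
  (isLineInvariant_mem_iff_nonDisturbing n D p₁ Q hP U hU bk hbk0 _ (chirp_ne_zero p₁ Q) M).1 hM b hb w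

/-- The complement of a line-invariant set is line-invariant. [folklore] -/
theorem isLineInvariant_compl {U : Finset (Fin (n + 1))} {bk : Fin (n + 1) → ℤ}
    {M : Set (Fin (n + 1) → ZN D p₁ Q)} (hM : IsLineInvariant n D p₁ Q U bk (fun x => x ∈ M)) :
    IsLineInvariant n D p₁ Q U bk (fun x => x ∈ Mᶜ) := by
  intro b hb v' j j'
  exact congrArg Not (hM b hb v' j j')

/-- THE ADAPTIVE HARVEST: at history `h`, either apply Chen's public Step-8 stabiliser `E₈` (a
one-outcome stage: outcome `none ↦ E₈`, the other outcomes have the zero operator) or measure the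
two-outcome instrument `{𝟙_{M h}, 𝟙_{(M h)ᶜ}}` (outcomes `some true` / `some false`) for a set `M h`
chosen as a function of the outcomes observed so far; the predicate `useE8 h` says which.
[cite: ChenQuantumLattice2024, Claim 3.14 pp. 33–34, §3.5.9 p. 35] -/
noncomputable def harvestStep (U : Finset (Fin (n + 1))) (bk : Fin (n + 1) → ℤ)
    (useE8 : List (Option Bool) → Prop) [DecidablePred useE8]
    (M : List (Option Bool) → Set (Fin (n + 1) → ZN D p₁ Q)) :
    List (Option Bool) → Option Bool →
      (Ket (n + 1) ((D * D * (p₁ * Q) : ℕ+) : ℕ) →ₗ[ℂ] Ket (n + 1) ((D * D * (p₁ * Q) : ℕ+) : ℕ)) :=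
  fun h κ =>
    if useE8 h then (match κ with | none => step8Op n D p₁ Q U bk | some _ => 0)
    else (match κ with | none => 0 | some true => branchOp (M h) | some false => branchOp (M h)ᶜ)

/-- **The adaptive harvest of line invariants (interleaved with Step 8) is a safe adaptive protocol** —
hence, by `AdaptiveSafe.histProb_indep`, its transcript is class-blind: harvesting adaptively buys
nothing over harvesting once. [cite: ChenQuantumLattice2024, Claim 3.14 pp. 33–34, §3.5.9 pp. 34–38] -/
theorem adaptiveSafe_harvest (hP : Odd ((p₁ * Q : ℕ+) : ℕ)) (hQ : Odd ((Q : ℕ+) : ℕ))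
    (hpQ : Nat.Coprime (p₁ : ℕ) (Q : ℕ)) {U : Finset (Fin (n + 1))} (hU : (0 : Fin (n + 1)) ∉ U)
    (hU' : U.Nonempty) {bk : Fin (n + 1) → ℤ} (hbk0 : bk 0 = -1) (v' : Fin (n + 1) → ℤ)
    (useE8 : List (Option Bool) → Prop) [DecidablePred useE8]
    (M : List (Option Bool) → Set (Fin (n + 1) → ZN D p₁ Q))
    (hM : ∀ h, IsLineInvariant n D p₁ Q U bk (fun x => x ∈ M h)) :
    AdaptiveSafe n D p₁ Q U bk v' (harvestStep n D p₁ Q U bk useE8 M) := by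
  refine AdaptiveSafe.of_forall_isCosetND (fun h κ => ?_) hP hQ hpQ hU hU' hbk0
  unfold harvestStep
  by_cases hu : useE8 h
  · rw [if_pos hu]
    cases κ with
    | none => exact (isClassND_step8Op n D p₁ Q hP hU hbk0).isCosetND v'
    | some _ => exact fun b _ w _ => ⟨0, by rw [LinearMap.zero_apply, zero_smul]⟩
  · rw [if_neg hu]
    rcases κ with _ | ⟨_ | _⟩
    · exact fun b _ w _ => ⟨0, by rw [LinearMap.zero_apply, zero_smul]⟩
    · exact (isClassND_branchOp_of_isLineInvariant n D p₁ Q hP hU hbk0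
        (isLineInvariant_compl n D p₁ Q (hM h))).isCosetND v'
    · exact (isClassND_branchOp_of_isLineInvariant n D p₁ Q hP hU hbk0 (hM h)).isCosetND v'

end Adaptive

end Literature.Computability.Cryptography.Chen2024

/-! ### Applied to an admissible shape -/

namespace Literature.Computability.Cryptography.Chen2024.Shape

open scoped BigOperators

variable (S : Shape)

/-- **T4, adaptive form, for Chen's shapes.**  `S` admissible (Cond. C.3), `U` a non-empty set of
unknown coordinates with `0 ∉ U`, `bk` public and equal to `S.b` off `U`, `b₂` any class secret
(another LWE instance with the same planted part), `w` any offset of the knowable coset of the true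
`S.v′`: every outcome history of a SAFE ADAPTIVE protocol has the same Born weight on the true state
`|φ_{S.b, S.v′}⟩` and on `|φ_{b₂, w}⟩`. [cite: ChenQuantumLattice2024, §3.5.9 pp. 34–38, Claim 3.14 pp. 33–34, eq. (12) p. 17, Cond. C.3 p. 18] -/
theorem adaptive_histProb_blind (h : S.Admissible) (U : Finset (Fin (S.n + 1)))
    (hU : (0 : Fin (S.n + 1)) ∉ U) (hU' : U.Nonempty) (bk b₂ : Fin (S.n + 1) → ℤ)
    (hbk : ∀ i, i ∉ U → bk i = S.b i) (hb₂ : ∀ i, i ∉ U → b₂ i = S.b i)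
    (hb₂U : ∀ i ∈ U, (2 * (S.p₁ : ℤ)) ∣ b₂ i) {K : Type*}
    (step : List K → K → (Ket (S.n + 1) ((S.D * S.D * (S.p₁ * S.Q) : ℕ+) : ℕ)
      →ₗ[ℂ] Ket (S.n + 1) ((S.D * S.D * (S.p₁ * S.Q) : ℕ+) : ℕ)))
    (hS : AdaptiveSafe S.n S.D S.p₁ S.Q U bk S.v' step) {w : Fin (S.n + 1) → ℤ}
    (hw : SameCoset S.n S.D S.p₁ S.Q U bk S.v' w) (hist : List K) :
    histProb step hist (phi8bKet S.n S.D S.p₁ S.Q b₂ w)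
      = histProb step hist (phi8bKet S.n S.D S.p₁ S.Q S.b S.v') := by
  have hbk0 : bk 0 = -1 := by rw [hbk 0 hU, h.b_head]
  have hSb : InClass S.n S.p₁ U bk S.b :=
    ⟨fun i hi => (hbk i hi).symm, fun i hi => h.b_tail i (fun h0 => hU (h0 ▸ hi))⟩
  have hb₂' : InClass S.n S.p₁ U bk b₂ :=
    ⟨fun i hi => (hb₂ i hi).trans (hbk i hi).symm, fun i hi => hb₂U i hi⟩
  exact hS.histProb_indep h.odd_P h.odd_Q h.cop_pQ hU hU' hbk0 hist hb₂' hw hSb (sameCoset_refl S.v')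

/-- **No safe adaptive repair supplies Step 9's datum, for Chen's shapes.**  For every `a ≢ 0 (mod Q)`
the true offset `S.v′` and its twin `S.v′ + d(a,0)` give every history the same Born weight, and for any
rule `g` computing the kick's guess from the history, at every history the guess is wrong for at least
one of the two. [cite: ChenQuantumLattice2024, §3.5 p. 22, §3.5.9 pp. 34–38, Cond. C.3 p. 18] -/
theorem adaptive_kick_wrong_on_a_twin (h : S.Admissible) (U : Finset (Fin (S.n + 1)))
    (hU : (0 : Fin (S.n + 1)) ∉ U) (hU' : U.Nonempty) (bk : Fin (S.n + 1) → ℤ)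
    (hbk : ∀ i, i ∉ U → bk i = S.b i) {K : Type*}
    (step : List K → K → (Ket (S.n + 1) ((S.D * S.D * (S.p₁ * S.Q) : ℕ+) : ℕ)
      →ₗ[ℂ] Ket (S.n + 1) ((S.D * S.D * (S.p₁ * S.Q) : ℕ+) : ℕ)))
    (hS : AdaptiveSafe S.n S.D S.p₁ S.Q U bk S.v' step) {a : ZQ S.Q} (ha : a ≠ 0)
    (g : List K → ZN S.D S.p₁ S.Q) (hist : List K) :
    histProb step hist (phi8bKet S.n S.D S.p₁ S.Q S.b S.v')
        = histProb step hist (phi8bKet S.n S.D S.p₁ S.Q S.b (centreShift S.n S.D S.p₁ S.Q U bk S.v' a)) ∧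
      (centreError S.n S.D S.p₁ S.Q S.v' (g hist) ≠ 0 ∨
        centreError S.n S.D S.p₁ S.Q (centreShift S.n S.D S.p₁ S.Q U bk S.v' a) (g hist) ≠ 0) := by
  have hbk0 : bk 0 = -1 := by rw [hbk 0 hU, h.b_head]
  have hSb : InClass S.n S.p₁ U bk S.b :=
    ⟨fun i hi => (hbk i hi).symm, fun i hi => h.b_tail i (fun h0 => hU (h0 ▸ hi))⟩
  exact hS.kick_wrong_on_a_twin h.odd_P h.odd_Q h.cop_pQ h.cop_DQ hU hU' hbk0 h.isUnit_twoDD hSb ha g hist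

end Literature.Computability.Cryptography.Chen2024.Shape
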